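import Literature.MathematicalPhysics.QuantumLattice.GibbsEntropy
import Literature.MathematicalPhysics.QuantumLattice.LiebFluxPhaseProofs
import HarnessLib

/-!
# Route `KkFloor`, crux `KkBandLift` (stmt-HubbardSuperconductivity-10402), NEGATIVE side:
# block compression of quadratic forms and the thermal budget of a finite-dimensional Gibbs state

Generic finite-dimensional lemmas used by the thermal-shell witness
(`Theorems/KkBandLift/Negative/ThermalShellWitness.lean`):

* compression to a principal block `M.toBlock p p` versus vectors supported in / extended by zero
  from the block (`star_dotProduct_mulVec_eq_toBlock`, `star_dotProduct_mulVec_extend`,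
  `star_dotProduct_extend`, `isHermitian_toBlock`, `posSemidef_toBlock`);
* thermal states are variational states, `E₀(A) ≤ Re ω_β^K(A)` (`groundEnergy_le_re_gibbsState`);
  the entropy budget `Re ω_β(K) ≤ E₀(K) + log(dim)/β` (`re_gibbsState_self_le`, from
  `Matrix.IsHermitian.gibbsEntropy_le_log_card` and `exp_neg_mul_groundEnergy_le_partitionFn`);
* selection of a PURE state from a thermal budget (`exists_unit_of_gibbs_budget`): if
  `(Re ω(A) - E₀(A))/a + Re ω(P)/b ≤ 1` then a normalised ground vector of `(A - E₀(A))/a + P/b`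
  has `Re⟨v,Av⟩ ≤ E₀(A) + a` and `Re⟨v,Pv⟩ ≤ b`.

All folklore (Bratteli–Robinson II §5.3.1; Tasaki (2020) §2.1, App. A). No definitions.
HONEST FRAMING: support for a refutation verdict on route items 10402–10404, not summit progress.
-/

-- the mandated namespace `Summit.<Summit>.<Problem>.Theorems…` repeats `HubbardSuperconductivity`
-- (single-problem summit, D-0017), which the `dupNamespace` linter flags on every declaration
set_option linter.dupNamespace false

noncomputable section

namespace Summit.HubbardSuperconductivity.HubbardSuperconductivity.Theorems.KkBandLift.Negative

open Matrix Finset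
open Literature.MathematicalPhysics.QuantumLattice
open scoped ComplexOrder

/-! ### Block compression of quadratic forms -/

section Block

variable {ι : Type*} (p : ι → Prop)

/-- The extension by zero of a block vector restricts back to it. [folklore] -/
theorem extend_val_apply (v : {a // p a} → ℂ) (a : {a // p a}) :
    Function.extend Subtype.val v 0 (a : ι) = v a :=
  Subtype.val_injective.extend_apply v 0 a

/-- The extension by zero of a block vector vanishes off the block. [folklore] -/
theorem extend_val_apply_of_not (v : {a // p a} → ℂ) (i : ι) (hi : ¬ p i) :
    Function.extend Subtype.val v 0 i = 0 := by
  rw [Function.extend_apply' _ _ _ (fun ⟨a, ha⟩ => hi (ha ▸ a.2)), Pi.zero_apply]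

/-- The compression of a Hermitian matrix to a principal block is Hermitian. [folklore] -/
theorem isHermitian_toBlock {M : Matrix ι ι ℂ} (hM : M.IsHermitian) : (M.toBlock p p).IsHermitian :=
  hM.submatrix _

variable [Fintype ι] [DecidablePred p]

omit [Fintype ι] [DecidablePred p] in
/-- The compression of a positive semidefinite matrix to a principal block is positive
semidefinite. [folklore] -/
theorem posSemidef_toBlock [Fintype ι] [Fintype {a // p a}] {M : Matrix ι ι ℂ} (hM : M.PosSemidef) : (M.toBlock p p).PosSemidef :=
  hM.submatrix _

/-- A quadratic form of a vector supported in the block `p` is the quadratic form of the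
compressed matrix at the restricted vector. [folklore] -/
theorem star_dotProduct_mulVec_eq_toBlock (M : Matrix ι ι ℂ) (ψ : ι → ℂ)
    (hψ : ∀ i, ¬ p i → ψ i = 0) :
    star ψ ⬝ᵥ M *ᵥ ψ =
      star (fun a : {a // p a} => ψ a) ⬝ᵥ (M.toBlock p p) *ᵥ (fun a : {a // p a} => ψ a) := by
  simp only [dotProduct, mulVec, Pi.star_apply, toBlock_apply]
  rw [← Fintype.sum_subtype_add_sum_subtype p (fun i => star (ψ i) * ∑ j, M i j * ψ j)]
  have h0 : ∑ i : {x // ¬ p x}, star (ψ i) * ∑ j, M i j * ψ j = 0 :=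
    Finset.sum_eq_zero fun i _ => by rw [hψ i i.2, star_zero, zero_mul]
  rw [h0, add_zero]
  refine Finset.sum_congr rfl fun i _ => ?_
  congr 1
  rw [← Fintype.sum_subtype_add_sum_subtype p (fun j => M i j * ψ j)]
  have h1 : ∑ j : {x // ¬ p x}, M i j * ψ j = 0 :=
    Finset.sum_eq_zero fun j _ => by rw [hψ j j.2, mul_zero]
  rw [h1, add_zero]



/-- The norm of a vector supported in the block `p` is the norm of its restriction. [folklore] -/
theorem star_dotProduct_eq_toBlock [DecidableEq ι] (ψ : ι → ℂ) (hψ : ∀ i, ¬ p i → ψ i = 0) :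
    star ψ ⬝ᵥ ψ = star (fun a : {a // p a} => ψ a) ⬝ᵥ (fun a : {a // p a} => ψ a) := by
  have h := star_dotProduct_mulVec_eq_toBlock p (1 : Matrix ι ι ℂ) ψ hψ
  rwa [one_mulVec, show (1 : Matrix ι ι ℂ).toBlock p p = 1 from by
    ext a b
    simp only [toBlock_apply, one_apply, Subtype.ext_iff], one_mulVec] at h

/-- Quadratic forms of the extension by zero are the compressed quadratic forms. [folklore] -/
theorem star_dotProduct_mulVec_extend (M : Matrix ι ι ℂ) (v : {a // p a} → ℂ) :
    star (Function.extend Subtype.val v 0) ⬝ᵥ M *ᵥ (Function.extend Subtype.val v 0) =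
      star v ⬝ᵥ (M.toBlock p p) *ᵥ v := by
  rw [star_dotProduct_mulVec_eq_toBlock p M _ (fun i hi => extend_val_apply_of_not p v i hi)]
  simp only [extend_val_apply]

/-- The extension by zero preserves the norm. [folklore] -/
theorem star_dotProduct_extend [DecidableEq ι] (v : {a // p a} → ℂ) :
    star (Function.extend Subtype.val v 0) ⬝ᵥ (Function.extend Subtype.val v 0) = star v ⬝ᵥ v := by
  have h := star_dotProduct_mulVec_extend p (1 : Matrix ι ι ℂ) v
  rwa [one_mulVec, show (1 : Matrix ι ι ℂ).toBlock p p = 1 from by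
    ext a b
    simp only [toBlock_apply, one_apply, Subtype.ext_iff], one_mulVec] at h



end Block

/-! ### Thermal states of a finite-dimensional Hamiltonian: two elementary budget facts -/

section Thermal

variable {m : Type*} [Fintype m] [DecidableEq m]

variable [Nonempty m]

/-- A normalised vector whose Rayleigh quotient is the ground energy exists (Hermitian matrix,
nonempty index type). [folklore] -/
theorem exists_unit_rayleigh_eq_groundEnergy {A : Matrix m m ℂ} (hA : A.IsHermitian) :
    ∃ ψ : m → ℂ, star ψ ⬝ᵥ ψ = 1 ∧ (star ψ ⬝ᵥ A *ᵥ ψ).re = A.groundEnergy := by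
  obtain ⟨v, hv, hv0⟩ := (Submodule.ne_bot_iff _).1 (groundSpace_ne_bot_holds hA)
  have hpos : 0 < star v ⬝ᵥ v := dotProduct_star_self_pos_iff.2 hv0
  set r : ℝ := (star v ⬝ᵥ v).re with hr
  have hvv : star v ⬝ᵥ v = (r : ℂ) := by
    obtain ⟨-, him⟩ := Complex.nonneg_iff.mp hpos.le
    exact Complex.ext (by simp [hr]) (by simpa using him.symm)
  have hr0 : 0 < r := by
    have h := hpos
    rw [hvv, Complex.zero_lt_real] at h
    exact h
  set ψ : m → ℂ := (((Real.sqrt r)⁻¹ : ℝ) : ℂ) • v with hψ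
  have hψmem : ψ ∈ A.groundSpace := A.groundSpace.smul_mem _ hv
  have hψ1 : star ψ ⬝ᵥ ψ = 1 := by
    rw [hψ, star_smul, smul_dotProduct, dotProduct_smul, hvv, smul_eq_mul, smul_eq_mul,
      Complex.star_def, Complex.conj_ofReal, ← Complex.ofReal_mul, ← Complex.ofReal_mul,
      ← Complex.ofReal_one, Complex.ofReal_inj]
    have hs : Real.sqrt r ≠ 0 := (Real.sqrt_pos.2 hr0).ne'
    field_simp
    rw [Real.sq_sqrt hr0.le]
  exact ⟨ψ, hψ1, (rayleigh_eq_groundEnergy_iff_holds hA ψ hψ1).2 hψmem⟩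

/-- **Thermal states are variational states**: `E₀(A) ≤ Re ω_β^K(A)` for Hermitian `A` and the
Gibbs state of a Hermitian `K` (`ω(A - E₀(A)) ≥ 0` by positivity of `ω`). [folklore] -/
theorem groundEnergy_le_re_gibbsState {K A : Matrix m m ℂ} (hK : K.IsHermitian)
    (hA : A.IsHermitian) (β : ℝ) : A.groundEnergy ≤ (gibbsState β K A).re := by
  have h := gibbsState_nonneg_of_posSemidef β hK (posSemidef_sub_groundEnergy hA)
  rw [map_sub, Algebra.algebraMap_eq_smul_one, LinearMap.map_smul_of_tower,
    gibbsState_one β K (partitionFn_pos β hK).ne'] at h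
  obtain ⟨hre, -⟩ := Complex.nonneg_iff.mp h
  simp only [Complex.sub_re, Complex.real_smul, mul_one, Complex.ofReal_re] at hre
  linarith

/-- **The thermal energy budget**: `Re ω_β(K) ≤ E₀(K) + log(dim)/β` for `β > 0` — the Gibbs
entropy `log Z + β Re ω_β(K)` is at most `log dim` and `Z ≥ e^{-βE₀}`. [folklore] -/
theorem re_gibbsState_self_le {K : Matrix m m ℂ} (hK : K.IsHermitian) {β : ℝ} (hβ : 0 < β) :
    (gibbsState β K K).re ≤ K.groundEnergy + Real.log (Fintype.card m) / β := by
  have h1 := hK.gibbsEntropy_le_log_card β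
  rw [gibbsEntropy_def] at h1
  have h2 := exp_neg_mul_groundEnergy_le_partitionFn hK β
  have h3 : -(β * K.groundEnergy) ≤ Real.log (partitionFn β K).re := by
    have := Real.log_le_log (Real.exp_pos _) h2
    rwa [Real.log_exp] at this
  have h4 : (gibbsState β K K).re ≤ (β * K.groundEnergy + Real.log (Fintype.card m)) / β := by
    rw [le_div_iff₀ hβ]
    linarith
  calc (gibbsState β K K).re ≤ (β * K.groundEnergy + Real.log (Fintype.card m)) / β := h4
    _ = K.groundEnergy + Real.log (Fintype.card m) / β := by
        field_simp

/-- **Selection of a pure state from a thermal budget.** If the Gibbs state `ω` of a Hermitian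
`K` satisfies `(Re ω(A) - E₀(A))/a + Re ω(P)/b ≤ 1` for a Hermitian `A`, a positive semidefinite
`P` and `a, b > 0`, then some UNIT VECTOR `v` has `Re⟨v,Av⟩ ≤ E₀(A) + a` and `Re⟨v,Pv⟩ ≤ b`:
a normalised ground vector of `X = (A - E₀(A))/a + P/b`, whose ground energy is at most
`Re ω(X) ≤ 1` while both of its terms are nonnegative forms. [folklore] -/
theorem exists_unit_of_gibbs_budget {K A P : Matrix m m ℂ} (hK : K.IsHermitian)
    (hA : A.IsHermitian) (hP : P.PosSemidef) (β : ℝ) {a b : ℝ} (ha : 0 < a) (hb : 0 < b)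
    (h : ((gibbsState β K A).re - A.groundEnergy) / a + (gibbsState β K P).re / b ≤ 1) :
    ∃ v : m → ℂ, star v ⬝ᵥ v = 1 ∧ (star v ⬝ᵥ A *ᵥ v).re ≤ A.groundEnergy + a ∧
      (star v ⬝ᵥ P *ᵥ v).re ≤ b := by
  set X : Matrix m m ℂ := ((a⁻¹ : ℝ) : ℂ) • (A - algebraMap ℝ (Matrix m m ℂ) A.groundEnergy) +
    ((b⁻¹ : ℝ) : ℂ) • P with hX
  have hAE : (A - algebraMap ℝ (Matrix m m ℂ) A.groundEnergy).IsHermitian :=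
    (posSemidef_sub_groundEnergy hA).1
  -- a real multiple of a Hermitian matrix is Hermitian (`Matrix.IsHermitian.ofReal_smul` of the
  -- `XYOrder` stack, restated locally to keep the import closure small)
  have hsm : ∀ {M : Matrix m m ℂ}, M.IsHermitian → ∀ r : ℝ, ((r : ℂ) • M).IsHermitian :=
    fun hM r => by
      rw [IsHermitian, conjTranspose_smul, hM.eq, Complex.star_def, Complex.conj_ofReal]
  have hXh : X.IsHermitian := (hsm hAE _).add (hsm hP.1 _)
  have hZ : partitionFn β K ≠ 0 := (partitionFn_pos β hK).ne'
  -- the thermal expectation of `X`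
  have hωX : (gibbsState β K X).re =
      ((gibbsState β K A).re - A.groundEnergy) * a⁻¹ + (gibbsState β K P).re * b⁻¹ := by
    rw [hX, map_add, map_smul, map_smul, map_sub, Algebra.algebraMap_eq_smul_one,
      LinearMap.map_smul_of_tower, gibbsState_one β K hZ, smul_eq_mul, smul_eq_mul]
    simp only [Complex.add_re, Complex.mul_re, Complex.ofReal_re, Complex.ofReal_im, zero_mul,
      sub_zero, Complex.sub_re, Complex.real_smul, mul_one]
    ring
  have hE0X : X.groundEnergy ≤ 1 := by
    refine (groundEnergy_le_re_gibbsState hK hXh β).trans ?_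
    rw [hωX]
    simpa [div_eq_mul_inv] using h
  obtain ⟨v, hv1, hvX⟩ := exists_unit_rayleigh_eq_groundEnergy hXh
  have hform : (star v ⬝ᵥ X *ᵥ v).re =
      ((star v ⬝ᵥ A *ᵥ v).re - A.groundEnergy) * a⁻¹ + (star v ⬝ᵥ P *ᵥ v).re * b⁻¹ := by
    rw [hX, add_mulVec, smul_mulVec, smul_mulVec, sub_mulVec, dotProduct_add,
      dotProduct_smul, dotProduct_smul, dotProduct_sub, Algebra.algebraMap_eq_smul_one,
      smul_mulVec, one_mulVec, dotProduct_smul, hv1, smul_eq_mul, smul_eq_mul]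
    simp only [Complex.add_re, Complex.mul_re, Complex.ofReal_re, Complex.ofReal_im, zero_mul,
      sub_zero, Complex.sub_re, Complex.real_smul, mul_one]
    ring
  have h1 : 0 ≤ (star v ⬝ᵥ A *ᵥ v).re - A.groundEnergy :=
    sub_nonneg.2 (groundEnergy_le_rayleigh_holds hA v hv1)
  have h2 : 0 ≤ (star v ⬝ᵥ P *ᵥ v).re := (Complex.nonneg_iff.mp (hP.dotProduct_mulVec_nonneg v)).1
  have hsum : ((star v ⬝ᵥ A *ᵥ v).re - A.groundEnergy) * a⁻¹ + (star v ⬝ᵥ P *ᵥ v).re * b⁻¹ ≤ 1 := by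
    rw [← hform, hvX]; exact hE0X
  have ha' : 0 < a⁻¹ := inv_pos.2 ha
  have hb' : 0 < b⁻¹ := inv_pos.2 hb
  refine ⟨v, hv1, ?_, ?_⟩
  · have h3 : ((star v ⬝ᵥ A *ᵥ v).re - A.groundEnergy) * a⁻¹ ≤ 1 := by
      nlinarith [mul_nonneg h2 hb'.le]
    rw [mul_inv_le_iff₀ ha, one_mul] at h3
    linarith
  · have h3 : (star v ⬝ᵥ P *ᵥ v).re * b⁻¹ ≤ 1 := by
      nlinarith [mul_nonneg h1 ha'.le]
    rw [mul_inv_le_iff₀ hb, one_mul] at h3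
    exact h3

end Thermal

end Summit.HubbardSuperconductivity.HubbardSuperconductivity.Theorems.KkBandLift.Negative

end
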